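import Mathlib.Geometry.Manifold.Instances.Sphere
import Mathlib.Geometry.Manifold.ContMDiff.Atlas
import Mathlib.Geometry.Manifold.Diffeomorph
import Literature.Topology.FourManifolds.InvertedGermExtension
import Literature.Topology.FourManifolds.PalaisBallComplement
import HarnessLib

/-!
# Antipodal stereographic charts differ by the inversion; charts and restrictions as diffeomorphisms

Trunk `Literature/Topology/FourManifolds` (support for the discharge of
`Literature.Geometry.Symplectic.palais_puncturedSphere_chartForm`,
`Literature/Geometry/Symplectic/GromovMcDuffChartForm.lean`).
Everything here is PROVED.

## Contents

* `Literature.Topology.FourManifolds.coe_stereographic_eq_four_smul_sphereInversion`: for `x ≠ ±v` on the unit sphere of a real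
  inner product space, Mathlib's stereographic projections from the antipodal poles `v` and `-v`
  satisfy `stereo_v (x) = 4 • ι (stereo_{-v} (x))` in `E`, `ι z = z / ‖z‖²`
  (`Literature.Topology.FourManifolds.sphereInversion`); the factor `4` reflects Mathlib's convention (projection onto the
  hyperplane `vᗮ` through the centre, so the equator goes to the sphere of radius `2`).
* `Literature.Topology.FourManifolds.stereographic'_eq_four_smul_transfer_sphereInversion`: the same for the `ℝⁿ`-valued charts
  `stereographic' n (±v)`, up to the linear isometry `Literature.stereoTransfer v` of `ℝⁿ` comparing the
  two (arbitrary) orthonormal identifications `vᗮ ≃ ℝⁿ` chosen by Mathlib; and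
  `Literature.Topology.FourManifolds.chartAt_sphere_neg_eq` — the `chartAt` form on `𝕊ⁿ ⊆ ℝⁿ⁺¹`.
* `Literature.Topology.FourManifolds.chartDiffeomorph`: a compatible chart with target `univ` is a diffeomorphism from its source
  (an open submanifold) onto the model space; `chartAt` specialisations for the sphere
  (`Literature.chartAt_sphere_*`, `Literature.Topology.FourManifolds.contMDiff_chartAt_sphere_symm`), the last two being one-line
  `chartAt` forms of `Literature.Topology.FourManifolds.stereographic'_symm_zero` / `Literature.Topology.FourManifolds.contMDiff_stereographic'_symm` of
  `PalaisBallComplement.lean` (recall `chartAt v = stereographic' n (-v)`). Restrictions of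
  diffeomorphisms to open submanifolds are `Literature.Topology.FourManifolds.opensCongr` of that file and are not repeated.

This addresses the `TODO` of `Mathlib.Geometry.Manifold.Instances.Sphere` ("relate the
stereographic projection to the inversion of the space") in the form needed here. Relation to
`Literature.Topology.FourManifolds.poleReflection_stereographic'_symm` (`PalaisBallComplement.lean`), which expresses the same
geometry as `R (σᵥ⁻¹ z) = σᵥ⁻¹ (4 z / ‖z‖²)` for the reflection `R` in `vᗮ` and ONE chart `σᵥ`:
the present identity compares the TWO charts at antipodal poles (`σ_v = 4 • ι ∘ σ_{-v}` in `E`,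
no reflection), which is the form in which the transition `chartAt (-q) ∘ (chartAt q)⁻¹` of
Mathlib's atlas of the sphere enters `GromovMcDuffChartFormProofs.lean`; passing between the two
forms would require the additional identity `σᵥ ∘ R = σ_{-v}` in `E` together with the unpacking
of Mathlib's identifications `vᗮ ≃ ℝⁿ`, so the direct computation is given.

## References

* M. W. Hirsch, *Differential Topology*, GTM 33 (1976), §1.1 (stereographic atlas of `Sⁿ`, the
  transition map is `x ↦ x/‖x‖²`).
* J. M. Lee, *Introduction to Smooth Manifolds*, 2nd ed. (2013), Problem 1-7, Example 1.4.
-/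

open scoped Manifold ContDiff Topology InnerProductSpace RealInnerProductSpace
open Function Set Metric Module TopologicalSpace

noncomputable section

namespace Literature.Topology.FourManifolds

section StereographicInversion

variable {E : Type*} [NormedAddCommGroup E] [InnerProductSpace ℝ E]


/-- The line spanned by `-v` is the line spanned by `v`. [folklore] -/
theorem span_singleton_neg_eq (v : E) : (ℝ ∙ (-v)) = ℝ ∙ v := by
  apply le_antisymm
  · rw [Submodule.span_singleton_le_iff_mem]
    exact Submodule.neg_mem _ (Submodule.mem_span_singleton_self v)
  · rw [Submodule.span_singleton_le_iff_mem]
    simpa using Submodule.neg_mem _ (Submodule.mem_span_singleton_self (-v))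

/-- The hyperplanes orthogonal to `v` and to `-v` coincide. [folklore] -/
theorem orthogonal_span_neg_eq (v : sphere (0 : E) 1) :
    (ℝ ∙ ((-v : sphere (0 : E) 1) : E))ᗮ = (ℝ ∙ (v : E))ᗮ := by
  rw [coe_neg_sphere, span_singleton_neg_eq]

/-- On the subspace `Kᗮ`, the inversion of the subspace is the restriction of the inversion of `E`.
[folklore] -/
theorem coe_sphereInversion_submodule (K : Submodule ℝ E) (w : K) :
    ((sphereInversion w : K) : E) = sphereInversion (w : E) := by
  simp [sphereInversion, Submodule.coe_norm]

/-- **The two antipodal stereographic projections are exchanged by the inversion**: for `x` on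
the unit sphere different from `±v`, `stereo_v (x) = 4 • ι (stereo_{-v} (x))` as vectors of `E`
(both lie in `vᗮ`). [folklore] -/
theorem coe_stereographic_eq_four_smul_sphereInversion (v : sphere (0 : E) 1) (x : sphere (0 : E) 1)
    (hxv : x ≠ v) (hxv' : x ≠ -v) :
    ((stereographic (norm_eq_of_mem_sphere v) x : (ℝ ∙ (v : E))ᗮ) : E) =
      (4 : ℝ) • sphereInversion
        ((stereographic (norm_eq_of_mem_sphere (-v)) x :
          (ℝ ∙ ((-v : sphere (0 : E) 1) : E))ᗮ) : E) := by
  have hv : ‖(v : E)‖ = 1 := norm_eq_of_mem_sphere v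
  set a : ℝ := ⟪(v : E), x⟫ with ha
  set P : E := (x : E) - a • (v : E) with hP
  have hproj : (((ℝ ∙ (v : E))ᗮ.orthogonalProjectionOnto x : (ℝ ∙ (v : E))ᗮ) : E) = P := by
    rw [Submodule.coe_orthogonalProjectionOnto_apply, Submodule.starProjection_orthogonal_val,
      Submodule.starProjection_unit_singleton ℝ hv]
  have hproj' : (((ℝ ∙ ((-v : sphere (0 : E) 1) : E))ᗮ.orthogonalProjectionOnto x :
      (ℝ ∙ ((-v : sphere (0 : E) 1) : E))ᗮ) : E) = P := by
    have hv' : ‖((-v : sphere (0 : E) 1) : E)‖ = 1 := norm_eq_of_mem_sphere (-v)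
    rw [Submodule.coe_orthogonalProjectionOnto_apply, Submodule.starProjection_orthogonal_val,
      Submodule.starProjection_unit_singleton ℝ hv']
    simp [hP, ha, inner_neg_left]
  -- `‖P‖² = 1 - a²`
  have hx1 : ‖(x : E)‖ = 1 := norm_eq_of_mem_sphere x
  have hPn : ‖P‖ ^ 2 = 1 - a ^ 2 := by
    have : ‖P‖ ^ 2 = ‖(x : E)‖ ^ 2 - 2 * a * ⟪(x : E), v⟫ + a ^ 2 * ‖(v : E)‖ ^ 2 := by
      rw [hP, @norm_sub_sq_real, inner_smul_right, norm_smul, Real.norm_eq_abs, mul_pow, sq_abs]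
      ring
    rw [this, hx1, hv, real_inner_comm, ← ha]; ring
  -- `a ≠ ±1`
  have ha1 : a ≠ 1 := by
    intro h
    apply hxv
    rw [sphere_ext_iff, real_inner_comm]; exact h
  have ha1' : a ≠ -1 := by
    intro h
    apply hxv'
    rw [sphere_ext_iff, real_inner_comm]
    simp [← ha, h, inner_neg_left]
  have h1a : 1 - a ≠ 0 := sub_ne_zero.2 (Ne.symm ha1)
  have h1a' : 1 + a ≠ 0 := by
    intro h; apply ha1'; linarith
  have hPn0 : ‖P‖ ^ 2 ≠ 0 := by
    rw [hPn]
    have : (1 - a ^ 2) = (1 - a) * (1 + a) := by ring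
    rw [this]; exact mul_ne_zero h1a h1a'
  -- compute both sides
  rw [stereographic_apply, stereographic_apply, Submodule.coe_smul, Submodule.coe_smul, hproj,
    hproj',
    sphereInversion.apply_smul, sphereInversion, smul_smul, smul_smul]
  congr 1
  simp only [coe_neg_sphere, inner_neg_left, ← ha]
  have h1a2 : 1 - a ^ 2 ≠ 0 := by rw [← hPn]; exact hPn0
  rw [hPn]
  field_simp
  ring

variable {n : ℕ} [Fact (finrank ℝ E = n + 1)]

/-- The linear isometry of `ℝⁿ` comparing the (arbitrary) identifications `vᗮ ≃ ℝⁿ` used by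
Mathlib's charts `stereographic' n v` and `stereographic' n (-v)` of the sphere. [folklore] -/
def stereoTransfer (v : sphere (0 : E) 1) :
    EuclideanSpace ℝ (Fin n) ≃ₗᵢ[ℝ] EuclideanSpace ℝ (Fin n) :=
  ((OrthonormalBasis.fromOrthogonalSpanSingleton (𝕜 := ℝ) n
      (ne_zero_of_mem_unit_sphere (-v))).repr.symm.trans
    (LinearIsometryEquiv.ofEq _ _ (orthogonal_span_neg_eq v))).trans
    (OrthonormalBasis.fromOrthogonalSpanSingleton (𝕜 := ℝ) n (ne_zero_of_mem_unit_sphere v)).repr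

/-- **Antipodal stereographic charts and the inversion.** For `x ≠ ±v` on the sphere,
`stereographic' n v x = 4 • L (ι (stereographic' n (-v) x))` with `L = stereoTransfer v` a linear
isometry of `ℝⁿ` and `ι` the inversion in the unit sphere: the transition between the charts at
antipodal points is the inversion up to the factor `4` (radius-`2` conventions) and an isometry.
[folklore] -/
theorem stereographic'_eq_four_smul_transfer_sphereInversion (v x : sphere (0 : E) 1) (hxv : x ≠ v)
    (hxv' : x ≠ -v) :
    stereographic' n v x =
      (4 : ℝ) • stereoTransfer v (sphereInversion (stereographic' n (-v) x)) := by
  set Bv := (OrthonormalBasis.fromOrthogonalSpanSingleton (𝕜 := ℝ) n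
    (ne_zero_of_mem_unit_sphere v)).repr
    with hBv
  set Bv' := (OrthonormalBasis.fromOrthogonalSpanSingleton (𝕜 := ℝ) n
    (ne_zero_of_mem_unit_sphere (-v))).repr
    with hBv'
  have h1 : stereographic' n v x = Bv (stereographic (norm_eq_of_mem_sphere v) x) := rfl
  have h2 : stereographic' n (-v) x = Bv' (stereographic (norm_eq_of_mem_sphere (-v)) x) := rfl
  rw [h1, h2, stereoTransfer, ← hBv, ← hBv', sphereInversion.apply_linearIsometryEquiv]
  simp only [LinearIsometryEquiv.trans_apply, LinearIsometryEquiv.symm_apply_apply]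
  rw [← map_smul]
  congr 1
  apply Subtype.ext
  rw [Submodule.coe_smul, LinearIsometryEquiv.coe_ofEq_apply, coe_sphereInversion_submodule]
  exact coe_stereographic_eq_four_smul_sphereInversion v x hxv hxv'


end StereographicInversion

section ChartDiffeomorph

variable {EM : Type*} [NormedAddCommGroup EM] [NormedSpace ℝ EM] {HM : Type*} [TopologicalSpace HM]
  {I : ModelWithCorners ℝ EM HM}
  {EN : Type*} [NormedAddCommGroup EN] [NormedSpace ℝ EN] {HN : Type*} [TopologicalSpace HN]
  {J : ModelWithCorners ℝ EN HN}
  {M : Type*} [TopologicalSpace M] [ChartedSpace HM M]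
  {N : Type*} [TopologicalSpace N] [ChartedSpace HN N]

/-- **A global chart is a diffeomorphism onto the model.** If `e` is a compatible chart of the
`C^∞` manifold `N` (a member of the maximal atlas) with `e.target = univ`, then `e` restricted to
the open submanifold `U = e.source` is a diffeomorphism `U ≅ H`. [folklore] -/
def chartDiffeomorph (e : OpenPartialHomeomorph N HN) (he : e ∈ IsManifold.maximalAtlas J ∞ N)
    (htarget : e.target = univ) (U : Opens N) (hU : (U : Set N) = e.source) : U ≃ₘ⟮J, J⟯ HN where
  toFun x := e x
  invFun y := ⟨e.symm y, by
    rw [← SetLike.mem_coe, hU]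
    exact e.map_target (by rw [htarget]; exact mem_univ _)⟩
  left_inv x := Subtype.ext (e.left_inv (show (x : N) ∈ e.source by rw [← hU]; exact x.2))
  right_inv y := e.right_inv (by rw [htarget]; exact mem_univ _)
  contMDiff_toFun := fun x =>
    contMDiffAt_subtype_iff.2 (contMDiffAt_of_mem_maximalAtlas he (by rw [← hU]; exact x.2))
  contMDiff_invFun := by
    apply (ContMDiff.subtypeVal_comp_iff U _).1
    have : ContMDiffOn J J ∞ e.symm univ := htarget ▸ contMDiffOn_symm_of_mem_maximalAtlas he
    exact contMDiffOn_univ.1 this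

/-- `chartDiffeomorph e _ _ U _` is `e` on points. [folklore] -/
@[simp] theorem chartDiffeomorph_apply (e : OpenPartialHomeomorph N HN)
    (he : e ∈ IsManifold.maximalAtlas J ∞ N) (htarget : e.target = univ) (U : Opens N)
    (hU : (U : Set N) = e.source) (x : U) : chartDiffeomorph e he htarget U hU x = e x := rfl

end ChartDiffeomorph

/-! ### The charts of the sphere -/

section SphereCharts

variable {E : Type*} [NormedAddCommGroup E] [InnerProductSpace ℝ E] {n : ℕ}
  [Fact (finrank ℝ E = n + 1)]

/-- Every stereographic chart `stereographic' n v` belongs to the maximal `C^∞` atlas of the sphere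
(it is in the defining atlas). [folklore] -/
theorem stereographic'_mem_maximalAtlas (v : sphere (0 : E) 1) :
    stereographic' n v ∈ IsManifold.maximalAtlas (𝓡 n) ∞ (sphere (0 : E) 1) :=
  IsManifold.subset_maximalAtlas ⟨v, rfl⟩

/-- The chart from the pole `-v` sends `v` to the origin. [folklore] -/
theorem stereographic'_neg_apply_self (v : sphere (0 : E) 1) : stereographic' n (-v) v = 0 := by
  show (OrthonormalBasis.fromOrthogonalSpanSingleton (𝕜 := ℝ) n
    (ne_zero_of_mem_unit_sphere (-v))).repr (stereographic (norm_eq_of_mem_sphere (-v)) v) = 0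
  rw [stereographic_neg_apply, map_zero]

/-- `chartAt v v = 0` on the sphere. [folklore] -/
theorem chartAt_sphere_apply_self (v : sphere (0 : E) 1) :
    chartAt (EuclideanSpace ℝ (Fin n)) v v = 0 :=
  stereographic'_neg_apply_self v

/-- `(chartAt v).symm 0 = v` on the sphere (`chartAt` form of `Literature.Topology.FourManifolds.stereographic'_symm_zero`,
`PalaisBallComplement.lean`). [folklore] -/
theorem chartAt_sphere_symm_zero (v : sphere (0 : E) 1) :
    (chartAt (EuclideanSpace ℝ (Fin n)) v).symm 0 = v := by
  rw [show chartAt (EuclideanSpace ℝ (Fin n)) v = stereographic' n (-v) from rfl,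
    stereographic'_symm_zero, neg_neg]

/-- The preferred chart at `v` (projection from the antipode `-v`) has source `{-v}ᶜ`. [folklore] -/
theorem chartAt_sphere_source (v : sphere (0 : E) 1) :
    (chartAt (EuclideanSpace ℝ (Fin n)) v).source = {-v}ᶜ :=
  stereographic'_source (-v)

/-- The preferred chart at `v` is onto `ℝⁿ`. [folklore] -/
theorem chartAt_sphere_target (v : sphere (0 : E) 1) :
    (chartAt (EuclideanSpace ℝ (Fin n)) v).target = univ :=
  stereographic'_target (-v)

/-- The chart at `v` vanishes only at `v` on its source. [folklore] -/
theorem chartAt_sphere_ne_zero {v x : sphere (0 : E) 1} (hx : x ≠ v) (hx' : x ≠ -v) :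
    chartAt (EuclideanSpace ℝ (Fin n)) v x ≠ 0 := by
  rw [← chartAt_sphere_apply_self v]
  intro h
  have hxs : x ∈ (chartAt (EuclideanSpace ℝ (Fin n)) v).source := by
    rw [chartAt_sphere_source]; exact hx'
  exact hx ((chartAt _ v).injOn hxs (mem_chart_source _ v) h)

/-- The inverse chart of the sphere is smooth on all of `ℝⁿ` (`chartAt` form of
`Literature.Topology.FourManifolds.contMDiff_stereographic'_symm`, `PalaisBallComplement.lean`). [folklore] -/
theorem contMDiff_chartAt_sphere_symm (v : sphere (0 : E) 1) :
    ContMDiff (𝓡 n) (𝓡 n) ∞ (chartAt (EuclideanSpace ℝ (Fin n)) v).symm :=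
  contMDiff_stereographic'_symm (-v)

end SphereCharts


/-! ### The concrete spheres `𝕊ⁿ ⊆ ℝⁿ⁺¹` -/

section ConcreteSphere

variable {n : ℕ}

/-- **`chartAt` form of the antipodal identity on `𝕊ⁿ ⊆ ℝⁿ⁺¹`.** For `x ≠ ±q`:
`chartAt (-q) x = 4 • L (ι (chartAt q x))` with `L = stereoTransfer q` (recall
`chartAt q = stereographic' n (-q)` is the projection from the antipode). The `Fact` hypothesis
(Mathlib's `finrank_euclideanSpace_fin`, registered only inline in
`Mathlib.Geometry.Manifold.Instances.Sphere`; cf. `Literature.Topology.FourManifolds.fact_finrank_euclideanSpace_succ` of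
`ClosedBall.lean`) is needed to *state* `stereoTransfer q`; supply it with
`haveI : Fact (finrank ℝ (EuclideanSpace ℝ (Fin (n + 1))) = n + 1) := ⟨finrank_euclideanSpace_fin⟩`.
[folklore] -/
theorem chartAt_sphere_neg_eq [Fact (finrank ℝ (EuclideanSpace ℝ (Fin (n + 1))) = n + 1)]
    (q x : sphere (0 : EuclideanSpace ℝ (Fin (n + 1))) 1) (hxq : x ≠ q) (hxq' : x ≠ -q) :
    chartAt (EuclideanSpace ℝ (Fin n)) (-q) x =
      (4 : ℝ) • stereoTransfer (n := n) q
        (sphereInversion (chartAt (EuclideanSpace ℝ (Fin n)) q x)) := by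
  have h := stereographic'_eq_four_smul_transfer_sphereInversion (n := n) q x hxq hxq'
  have h1 : chartAt (EuclideanSpace ℝ (Fin n)) (-q) x = stereographic' n q x := by
    show stereographic' n (- -q) x = _
    rw [neg_neg]
  rw [h1, h]
  rfl

end ConcreteSphere

end Literature.Topology.FourManifolds

end
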